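import Summits.ABC.IUTFork.Cor312PilotIdelesMNumbersSummand
import Summits.ABC.IUTFork.Cor312ThetaSideClosedM
import HarnessLib

/-!
# [IUTchIII] Corollary 3.12 AT THE M-LEVEL GENUINE REAL SETTING implies the Dupuy–Hilado inequality of the datum:
# `Statement (setting of the datum's own ideles) → I.Cor312Of` — NO hypothesis (G1-Θ endgame, both routes)

PROOF-ONLY record file (D-0012; no definitions) of the abc-iut cell (seat abc-iut-w5-d244, gen 8; branch C «abc ⇐ S», C-lead ruling C-R12 (e)
«target #2′: the M-level (V̲, K_{v̲}) real volume setting»). TAKES NO SIDE on [IUTchIII] Cor. 3.12.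

The typed statement of [IUTchIII] Cor. 3.12 (abc-iut-c312-7's FROZEN `Cor312.Setting.Statement`, kurims `paper:url-4b091feeb646` p. 174
l. 16–18: "`−|log(Θ)| ∈ ℝ`, and `−|log(Θ)| ≥ −|log(q)|`") is a `Prop` over a `Cor312.Setting`; abc-iut-S2's `ThetaVolumeInput.Cor312Of`
(`GenuineLogTheta`: `−|log(q)| ≤ −|log(Θ)|` computed from the GENUINE completions `K_{v̲}` and ideles of a Θ-volume input `I`, Dupuy–Hilado
§3.9–§4) is the number-level inequality the branch-C chain feeds into [IUTchIV] Thm. 1.10. The G1-Θ route-β port built the Cor. 3.12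
crew's setting OVER THOSE SAME CARRIERS — abc-iut-s2-p8's summand-route `settingPrVolSharpM` / abc-iut-w5-d166's frames-route `settingMSharp`
with the pilot regions read off the datum's OWN ideles (`tOfIdeleData`, `tqM` of abc-iut-w5-d033) — and PROVED, with no residual hypothesis:
* the `q`-side: `P.negLogQ = I.negAbsLogQ` (this seat, `negLogQ_settingPrVolSharpM_ideleDataOf_eq_negAbsLogQ` /
  `negLogQ_settingMSharp_ideleDataOf_eq_negAbsLogQ`, p440575 — Dupuy–Hilado Thm. 3.10.1 (iii) over `F_mod`);
* the Θ-side: `P.negLogTheta ≤ ↑I.negLogTheta` (abc-iut-s2-p8 `negLogTheta_settingPrVolSharpM_tOfIdeleData_le_genuine` /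
  `negLogTheta_settingMSharp_le_of_isVolumeInputOf`, p440655, over abc-iut-w5-d166 p438889 / abc-iut-s2-p7 p439554 — [IUTchIV] Thm. 1.10
  Step (v) orbit-hull bound, Step (vi) vanishing, Step (viii) reduction).
THIS FILE records the one-line consequence the adjudication quotes: **`cor312Of_of_statement_settingPrVolSharpM` /
`cor312Of_of_statement_settingMSharp` — if the typed Cor. 3.12 holds at the M-level genuine setting of a volume input `I` of `D` (for ANY
context binders: number field of the global realified Frobenioid, archimedean packets, splitting-monoid/lattice/link data, Kummer column, any
finite `Sq` off which the `q`-ideles are units), then `I.Cor312Of`.** And the number-level REFORMULATION of the typed statement at that setting: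
`statement_settingPrVolSharpM_iff_negAbsLogQ_le` (`Statement ↔ −|log(Θ)| ≠ ⊤ ∧ ↑I.negAbsLogQ ≤ −|log(Θ)|`). The converse
`I.Cor312Of → Statement` is NOT claimed (the Θ-side identification is one-sided: `≤`).

[cite: Mochizuki2012, IUTchIII Cor. 3.12 p. 173–174] [cite: Mochizuki2012, IUTchIV Thm. 1.10 p. 23, Steps (v)–(viii) p. 27–30]
[cite: DupuyHilado2025, §3.9, Thm. 3.10.1, §4.10] [claim: Mochizuki2012, status: disputed] for the quoted statement. HONEST FRAMING: an
implication between OUR typed objects; nothing here asserts that either side holds; no side taken on [IUTchIII] Cor. 3.12; typed ≠ proved;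
instantiated ≠ endorsed.
-/

noncomputable section

open Set Function NumberField IsDedekindDomain

namespace Summit.ABC.IUTFork.Thm311.Real

open Cor312 Cor312Vol Cor312Prov Literature.IUT.LogThetaLattice Literature.IUT.LogVolume Literature.IUT.HodgeTheaters
  Literature.NumberTheory.NumberFields

variable {F K Fbar : Type} [Field F] [NumberField F] [Field K] [NumberField K] [Algebra F K]
  [Field Fbar] [Algebra F Fbar] [Algebra K Fbar] {E : WeierstrassCurve F} [E.IsElliptic] {l : ℕ}
  {Pb : BadPlacePredicates K} (D : InitialThetaData F K Fbar E l Pb) {logvK : PadicLogsVal K}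
  (hlog : LogvAnalyticVal logvK) {I : ThetaVolumeInput (fieldOfModuli E) K} (hI : ThetaData.IsVolumeInputOf D I)
  (M : Type) [Field M] [NumberField M]
  (archPk : ∀ (j : (thetaIndexOfInitial D).Label) (vQ : (thetaIndexOfInitial D).VQ),
    Set ((logShellsOfInitialDH D logvK).Packet j vQ))
  (archSub : ∀ (j : (thetaIndexOfInitial D).Label) (v : (thetaIndexOfInitial D).V),
    Set ((logShellsOfInitialDH D logvK).Packet j ((thetaIndexOfInitial D).over v)))
  (Ψ : ℤ → ∀ v : (thetaIndexOfInitial D).V, v ∈ (thetaIndexOfInitial D).Vbad →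
    Set ((logShellsOfInitialDH D logvK).StarPacket v))
  (act : ℤ → ∀ v : (thetaIndexOfInitial D).V, v ∈ (thetaIndexOfInitial D).Vbad →
    (logShellsOfInitialDH D logvK).StarPacket v → Module.End ℚ ((logShellsOfInitialDH D logvK).StarPacket v))
  (Mmod : ℤ → ∀ j : (thetaIndexOfInitial D).LabelStar, Set ((logShellsOfInitialDH D logvK).GlobalPacket j.1))
  (region : ℤ → ∀ j : (thetaIndexOfInitial D).LabelStar, FinDivisor M → ∀ vQ : (thetaIndexOfInitial D).VQ,
    Set ((logShellsOfInitialDH D logvK).Packet j.1 vQ))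
  (n : ℤ) {HT : Type} {LogLink : HT → HT → Type} {IsFull : ∀ {s t : HT}, LogLink s t → Prop}
  (lat : LGPGaussianLogThetaLattice LogLink IsFull)
  {Frd : Type} {IsoF : Frd → Frd → Type} {Ob : Frd → Type} {realify : Frd → Frd} {Strip : Type}
  {IsoS : Strip → Strip → Type}
  {Mv : ∀ v : (thetaIndexOfInitial D).V, v ∈ (thetaIndexOfInitial D).Vbad → Type} [∀ v h, Monoid (Mv v h)]
  (sig : GlobalLGPFrobenioidSignature (thetaIndexOfInitial D).lstar (thetaIndexOfInitial D).V
    (· ∈ (thetaIndexOfInitial D).Vbad) Frd IsoF Ob realify Strip IsoS Mv)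
  (split : SplittingMonoids Mv) {ObΔ : Type}
  {N : ∀ v : (thetaIndexOfInitial D).V, v ∈ (thetaIndexOfInitial D).Vbad → Type} [∀ v h, Monoid (N v h)]
  (qData : QPilotData ObΔ N)
  (Sq : Finset (FinitePlace ℚ))
  (htq1 : ∀ (u : FinitePlace ℚ) (x : (thetaIndexOfInitial D).Fibre (Val.non u)), u ∉ Sq →
    ‖tqM D (ratChar u) u (natCast_ratChar_mem u) (ideleDataOf D hI) x‖ = 1)

/-! ## §1. Summand route (`settingPrVolSharpM`, abc-iut-s2-p8) -/

/-- **The typed Cor. 3.12 at the summand-route M-level genuine setting, REFORMULATED IN NUMBERS**: `Statement ↔ (−|log(Θ)| ≠ ⊤ ∧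
↑I.negAbsLogQ ≤ −|log(Θ)|)` — the `q`-side of the setting IS abc-iut-S2's `I.negAbsLogQ` (this seat's P5-numbers).
[cite: Mochizuki2012, IUTchIII Cor. 3.12 p. 174] -/
theorem statement_settingPrVolSharpM_iff_negAbsLogQ_le :
    (settingPrVolSharpM D hlog (tOfIdeleData D (ideleDataOf D hI))
        (fun u x => tqM D (ratChar u) u (natCast_ratChar_mem u) (ideleDataOf D hI) x) M archPk archSub Ψ act Mmod region n lat sig split
        qData (fun u x => tqM_ne_zero D (ratChar u) u (natCast_ratChar_mem u) (ideleDataOf D hI) x) Sq htq1).Statement ↔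
      (settingPrVolSharpM D hlog (tOfIdeleData D (ideleDataOf D hI))
          (fun u x => tqM D (ratChar u) u (natCast_ratChar_mem u) (ideleDataOf D hI) x) M archPk archSub Ψ act Mmod region n lat sig split
          qData (fun u x => tqM_ne_zero D (ratChar u) u (natCast_ratChar_mem u) (ideleDataOf D hI) x) Sq htq1).negLogTheta ≠ ⊤ ∧
        ((I.negAbsLogQ : ℝ) : WithTop ℝ) ≤
          (settingPrVolSharpM D hlog (tOfIdeleData D (ideleDataOf D hI))
            (fun u x => tqM D (ratChar u) u (natCast_ratChar_mem u) (ideleDataOf D hI) x) M archPk archSub Ψ act Mmod region n lat sig split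
            qData (fun u x => tqM_ne_zero D (ratChar u) u (natCast_ratChar_mem u) (ideleDataOf D hI) x) Sq htq1).negLogTheta := by
  unfold Setting.Statement
  rw [negLogQ_settingPrVolSharpM_ideleDataOf_eq_negAbsLogQ]

/-- **[IUTchIII] Cor. 3.12 AT THE SUMMAND-ROUTE M-LEVEL GENUINE SETTING IMPLIES THE DUPUY–HILADO INEQUALITY OF THE DATUM**: for a volume input
`I` of the initial Θ-data `D`, if the typed `Statement` holds at abc-iut-s2-p8's `settingPrVolSharpM` with the pilot regions read off `I`'s own
ideles (ANY context binders), then `I.Cor312Of` (`−|log(q)| ≤ −|log(Θ)|` of abc-iut-S2's genuine numbers). NO hypothesis: the `q`-side is this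
seat's number theorem, the Θ-side abc-iut-s2-p8's `negLogTheta_settingPrVolSharpM_tOfIdeleData_le_genuine` (∘ abc-iut-w5-d166 / abc-iut-s2-p7),
read at `r := ideleDataOf D hI` through abc-iut-w5-d033's `negLogTheta_eq_ideleDataOf`. [cite: Mochizuki2012, IUTchIII Cor. 3.12 p. 173–174] -/
theorem cor312Of_of_statement_settingPrVolSharpM
    (hst : (settingPrVolSharpM D hlog (tOfIdeleData D (ideleDataOf D hI))
        (fun u x => tqM D (ratChar u) u (natCast_ratChar_mem u) (ideleDataOf D hI) x) M archPk archSub Ψ act Mmod region n lat sig split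
        qData (fun u x => tqM_ne_zero D (ratChar u) u (natCast_ratChar_mem u) (ideleDataOf D hI) x) Sq htq1).Statement) :
    I.Cor312Of := by
  obtain ⟨-, hle⟩ := (statement_settingPrVolSharpM_iff_negAbsLogQ_le D hlog hI M archPk archSub Ψ act Mmod region n lat sig split qData Sq
    htq1).mp hst
  have hΘ := negLogTheta_settingPrVolSharpM_tOfIdeleData_le_genuine D hlog (ideleDataOf D hI)
    (fun u x => tqM D (ratChar u) u (natCast_ratChar_mem u) (ideleDataOf D hI) x) M archPk archSub Ψ act Mmod region n lat sig split qData
    (fun u x => tqM_ne_zero D (ratChar u) u (natCast_ratChar_mem u) (ideleDataOf D hI) x) Sq htq1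
  rw [← negLogTheta_eq_ideleDataOf D hI] at hΘ
  exact WithTop.coe_le_coe.mp (hle.trans hΘ)

/-! ## §2. Frames route (`settingMSharp`, abc-iut-w5-d166) -/

/-- The same number-level reformulation at the frames-route sharp setting. [cite: Mochizuki2012, IUTchIII Cor. 3.12 p. 174] -/
theorem statement_settingMSharp_iff_negAbsLogQ_le :
    (settingMSharp D hlog M archPk archSub Ψ act Mmod region n lat sig split qData (tOfIdeleData D (ideleDataOf D hI))
        (fun u x => tqM D (ratChar u) u (natCast_ratChar_mem u) (ideleDataOf D hI) x)
        (fun u x => tqM_ne_zero D (ratChar u) u (natCast_ratChar_mem u) (ideleDataOf D hI) x) Sq htq1).Statement ↔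
      (settingMSharp D hlog M archPk archSub Ψ act Mmod region n lat sig split qData (tOfIdeleData D (ideleDataOf D hI))
          (fun u x => tqM D (ratChar u) u (natCast_ratChar_mem u) (ideleDataOf D hI) x)
          (fun u x => tqM_ne_zero D (ratChar u) u (natCast_ratChar_mem u) (ideleDataOf D hI) x) Sq htq1).negLogTheta ≠ ⊤ ∧
        ((I.negAbsLogQ : ℝ) : WithTop ℝ) ≤
          (settingMSharp D hlog M archPk archSub Ψ act Mmod region n lat sig split qData (tOfIdeleData D (ideleDataOf D hI))
            (fun u x => tqM D (ratChar u) u (natCast_ratChar_mem u) (ideleDataOf D hI) x)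
            (fun u x => tqM_ne_zero D (ratChar u) u (natCast_ratChar_mem u) (ideleDataOf D hI) x) Sq htq1).negLogTheta := by
  unfold Setting.Statement
  rw [negLogQ_settingMSharp_ideleDataOf_eq_negAbsLogQ]

/-- **[IUTchIII] Cor. 3.12 AT THE FRAMES-ROUTE M-LEVEL GENUINE SETTING IMPLIES THE DUPUY–HILADO INEQUALITY OF THE DATUM** (`settingMSharp`,
abc-iut-w5-d166; Θ-side by abc-iut-s2-p8's `negLogTheta_settingMSharp_le_of_isVolumeInputOf`). NO hypothesis.
[cite: Mochizuki2012, IUTchIII Cor. 3.12 p. 173–174] -/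
theorem cor312Of_of_statement_settingMSharp
    (hst : (settingMSharp D hlog M archPk archSub Ψ act Mmod region n lat sig split qData (tOfIdeleData D (ideleDataOf D hI))
        (fun u x => tqM D (ratChar u) u (natCast_ratChar_mem u) (ideleDataOf D hI) x)
        (fun u x => tqM_ne_zero D (ratChar u) u (natCast_ratChar_mem u) (ideleDataOf D hI) x) Sq htq1).Statement) :
    I.Cor312Of := by
  obtain ⟨-, hle⟩ := (statement_settingMSharp_iff_negAbsLogQ_le D hlog hI M archPk archSub Ψ act Mmod region n lat sig split qData Sq
    htq1).mp hst
  have hΘ := negLogTheta_settingMSharp_le_of_isVolumeInputOf D hlog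
    (fun u x => tqM D (ratChar u) u (natCast_ratChar_mem u) (ideleDataOf D hI) x) M archPk archSub Ψ act Mmod region n lat sig split qData
    (fun u x => tqM_ne_zero D (ratChar u) u (natCast_ratChar_mem u) (ideleDataOf D hI) x) Sq htq1 hI
  exact WithTop.coe_le_coe.mp (hle.trans hΘ)

end Summit.ABC.IUTFork.Thm311.Real

end
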